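import Summits.ABC.StewartYu.PadicG3SatSchedule
import Summits.ABC.StewartYu.PadicG3SupplyHalfSharp
import Summits.ABC.StewartYu.PadicG3PackClosedP
import HarnessLib

/-!
# Cell abc-stewartyu, WP-L.P(odd) (crux r3 `PadicCoreOddRat`, stmt-ABC-20503): FRAME-SIDE SUPPLY of the saturated frame's step packages in
# CLOSED FORM — the k-step currency `KCsat` (virtual denominator `Dm`) and the half-step clearing `DCsat`/`MhCsat` (floor denominator `Dh`)

`Summits/ABC/StewartYu/PadicG3SatSupply.lean` — cell `abc-stewartyu` (HOME `run/shared/lean/pub/abc-stewartyu/`, design memo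
HOME/p2/memo-07-WPLP-odd-Nframe-design.md §2 row «ceilings/supplies»; seat p2-g6).  Definitions (`KCsat`, `DCsat`, `MhCsat` — closed forms) and
theorems on `G3Setup`; no named fact, no parameters.  Twins of `PadicG3PackClosedP.kStepHypU_of_ineqP` / `kStepOddHypU_of_ineqP` and of
`PadicG3SupplyHalfSharp.htermW_clearSharp` / `halfStepHypU_of_ineqSharp`, with the monomial clearing through the VIRTUAL box:

* `KCsat F U P L₀ H Ŝ lev Lc Bv x τ = 1 + U·P·M0C·XbC(Lc)^{|t|}·(F.Dm Bv x)²` — **`kStepHypSatU_of_ineqP`**, **`kStepOddHypSatU_of_ineqP`**: the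
  record packages `KStepHypSatU`/`KStepOddHypSatU` from ONE numerical inequality each (coefficient bound `BwP`, Hasse sizes `M0C`, directional
  ceiling `XbC` on the θ-box — all landed);
* `htermSW_clear` — integrality and size of the SIGNED half-point summand: `D·htermSW ∈ ℤ` for `D = ν(H)^{t₀}|b̃_{k₀}|^{|t|}·Dh(Bv, s₁)` and
  `|htermSW| ≤ 2^{t₀}·M₀′·Xb^{|t|}·Dh(Bv, s₁)` (`SatData.exists_int_Dh_mul_prod_floor`);
* `DCsat`, `MhCsat`, **`halfStepHypSatU_of_ineqSharp`** — `HalfStepHypSatU` from ONE inequality per `(s₁, τ)`.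

WHAT THIS IS NOT: the record's schedule and inequalities (p1 `PadicG3ParN` family + the pack); no crux moves.

References: Yu. V. Nesterenko, LNM 1819 (2003) §4.2–4.3, (4.50); K. Yu, Acta Math. 211 (2013) (5.35)–(5.41).
-/

noncomputable section

open NormedSpace Finset Polynomial
open scoped Matrix
open Literature.NumberTheory.Transcendental
open Literature.NumberTheory.Transcendental.PadicCW77 (condExp)
open Literature.NumberTheory.Transcendental.CW77.Setup (Tau tauNorm)
open scoped Nat

namespace Summit.ABC.StewartYu

namespace G3Setup

variable {p : ℕ} [Fact p.Prime] (S : G3Setup p) (F : S.SatData)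

/-! ### The k-step currency with the virtual denominator -/

/-- The Liouville constant of the saturated k-step: `KCsat = 1 + #U · P · M0C · XbC(Lc)^{|t|} · Dm(Bv, x)²`. [folklore] -/
def KCsat (U : ℕ) (P : ℤ) (L₀ H Sh lev : ℕ) (Lc Bv : Fin S.n → ℕ) (x : ℤ) (τ : Tau S.n) : ℝ :=
  1 + (U : ℝ) * P * ((M0C L₀ H Sh lev x τ.1 : ℝ) * (S.XbC Lc : ℝ) ^ (∑ k, τ.2 k) * ((F.Dm Bv x : ℝ)) ^ 2)

variable {S F}

/-- `0 ≤ M0C` and `0 ≤ XbC` (local copies of the positivity facts). [folklore] -/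
private theorem M0C_nonneg' (L₀ H Sh lev : ℕ) (x : ℤ) (t₀ : ℕ) : (0 : ℝ) ≤ M0C L₀ H Sh lev x t₀ := by
  have h0 : (0 : ℤ) ≤ M0C L₀ H Sh lev x t₀ := by unfold M0C; exact Int.ceil_nonneg (by positivity)
  exact_mod_cast h0

/-- `0 ≤ XbC` (local copy). [folklore] -/
private theorem XbC_nonneg' (S : G3Setup p) (L : Fin S.n → ℕ) : (0 : ℝ) ≤ S.XbC L := by
  have h0 : (0 : ℤ) ≤ S.XbC L := by
    unfold XbC
    exact mul_nonneg (by norm_num) (mul_nonneg (sum_nonneg fun j _ => abs_nonneg _) (sum_nonneg fun j _ => by positivity))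
  exact_mod_cast h0

variable (S F)

/-- `1 ≤ KCsat` for `P ≥ 0`. [folklore] -/
theorem one_le_KCsat (U : ℕ) {P : ℤ} (hP : 0 ≤ P) (L₀ H Sh lev : ℕ) (Lc Bv : Fin S.n → ℕ) (x : ℤ) (τ : Tau S.n) :
    1 ≤ S.KCsat F U P L₀ H Sh lev Lc Bv x τ := by
  unfold KCsat
  have hM := M0C_nonneg' L₀ H Sh lev x τ.1
  have hX := XbC_nonneg' S Lc
  have hP' : (0 : ℝ) ≤ P := by exact_mod_cast hP
  have : (0 : ℝ) ≤ (U : ℝ) * P * ((M0C L₀ H Sh lev x τ.1 : ℝ) * (S.XbC Lc : ℝ) ^ (∑ k, τ.2 k) * ((F.Dm Bv x : ℝ)) ^ 2) := by positivity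
  linarith

/-- **`KStepHypSatU` from one inequality (sharp `BwP`).** [cite: Nesterenko2003, §4.2; shape only] -/
theorem kStepHypSatU_of_ineqP {H : ℕ} (hH : 1 ≤ H) (L₀ Sh lev m : ℕ) (𝔏 : Finset (Fin S.n → ℤ)) (Lc Bv : Fin S.n → ℕ) (P : ℤ)
    (hP : (0 : ℤ) ≤ P) {N N' T T' t : ℕ} (ht : 1 ≤ t) (hT : T' + t ≤ T)
    (hfinal : ∀ x₁ : ℤ, |x₁| ≤ (N' : ℤ) → ∀ τ : Tau S.n, tauNorm τ + t ≤ T →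
      max (BwP (p := p) L₀ m * ‖S.Λ / (S.b S.j₀ : ℚ_[p])‖ * (p : ℝ) ^ ((t - 1) / 2) * (p : ℝ) ^ condExp p (2 * N + 1) t)
        (BwP (p := p) L₀ m / ((p : ℝ) ^ m * Real.sqrt p) ^ ((2 * N + 1) * t)) <
      1 / S.KCsat F (S.unk L₀ 𝔏).card P L₀ H Sh lev Lc Bv x₁ τ) :
    S.KStepHypSatU F (S.Rl H Sh lev) (S.unk L₀ 𝔏) Lc Bv P m N N' T T' := by
  refine ⟨t, BwP (p := p) L₀ m, fun (_ : ℤ) (τ : Tau S.n) => (Nat.lcmUpto H) ^ τ.1, fun (x : ℤ) (τ : Tau S.n) => M0C L₀ H Sh lev x τ.1,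
    S.XbC Lc, fun x τ => S.KCsat F (S.unk L₀ 𝔏).card P L₀ H Sh lev Lc Bv x τ, ht, hT, BwP_nonneg L₀ m, S.hBw_closedP L₀ hH Sh lev m 𝔏,
    fun _ τ => Nat.one_le_pow _ _ (Nat.lcmUpto_pos H), S.hR_closed hH L₀ Sh lev 𝔏, S.hXb_closed Lc, ?_, ?_, hfinal⟩
  · intro x τ
    exact lt_of_lt_of_le zero_lt_one (S.one_le_KCsat F _ hP L₀ H Sh lev Lc Bv x τ)
  · intro x τ
    show _ ≤ S.KCsat F _ P L₀ H Sh lev Lc Bv x τ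
    unfold KCsat
    linarith

/-- **`KStepOddHypSatU` from one inequality (sharp `BwP`).** [cite: Nesterenko2003, §4.2; shape only] -/
theorem kStepOddHypSatU_of_ineqP {H : ℕ} (hH : 1 ≤ H) (L₀ Sh lev m : ℕ) (𝔏 : Finset (Fin S.n → ℤ)) (Lc Bv : Fin S.n → ℕ) (P : ℤ)
    (hP : (0 : ℤ) ≤ P) {N N' T T' t : ℕ} (ht : 1 ≤ t) (hT : T' + t ≤ T)
    (hfinal : ∀ x₁ : ℤ, |x₁| ≤ (N' : ℤ) → ∀ τ : Tau S.n, tauNorm τ + t ≤ T →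
      max (BwP (p := p) L₀ m * ‖S.Λ / (S.b S.j₀ : ℚ_[p])‖ * (p : ℝ) ^ ((t - 1) / 2) * (p : ℝ) ^ condExp p (2 * N) t)
        (BwP (p := p) L₀ m / ((p : ℝ) ^ m * Real.sqrt p) ^ ((2 * N) * t)) <
      1 / S.KCsat F (S.unk L₀ 𝔏).card P L₀ H Sh lev Lc Bv x₁ τ) :
    S.KStepOddHypSatU F (S.Rl H Sh lev) (S.unk L₀ 𝔏) Lc Bv P m N N' T T' := by
  refine ⟨t, BwP (p := p) L₀ m, fun (_ : ℤ) (τ : Tau S.n) => (Nat.lcmUpto H) ^ τ.1, fun (x : ℤ) (τ : Tau S.n) => M0C L₀ H Sh lev x τ.1,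
    S.XbC Lc, fun x τ => S.KCsat F (S.unk L₀ 𝔏).card P L₀ H Sh lev Lc Bv x τ, ht, hT, BwP_nonneg L₀ m, S.hBw_closedP L₀ hH Sh lev m 𝔏,
    fun _ τ => Nat.one_le_pow _ _ (Nat.lcmUpto_pos H), S.hR_closed hH L₀ Sh lev 𝔏, S.hXb_closed Lc, ?_, ?_, hfinal⟩
  · intro x τ
    exact lt_of_lt_of_le zero_lt_one (S.one_le_KCsat F _ hP L₀ H Sh lev Lc Bv x τ)
  · intro x τ
    show _ ≤ S.KCsat F _ P L₀ H Sh lev Lc Bv x τ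
    unfold KCsat
    linarith

/-! ### The signed half-point summand: integrality and size -/

/-- **Integrality and size of the SIGNED half-step class-sum terms**: for `lev < Ŝ`, `H ≥ 1`, `|ν(w)ⱼ| ≤ Bvⱼ`, `|𝔛(w)ₖ| ≤ Xb`, and
`M₀′ ≥ 2^{(Ŝ−lev−1)t₀} ν(H)^{t₀} e^{H/e} (e(1 + 2^{Ŝ−lev−1}|s₁|/H))^{ℓ₀}`:
`D · htermSW ∈ ℤ` with `D = ν(H)^{t₀}|b̃_{k₀}|^{|t|}·Dh(Bv, s₁)`, and `|htermSW| ≤ 2^{t₀} M₀′ Xb^{|t|} Dh(Bv, s₁)`.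
[cite: Yu2013, (5.35)–(5.39)] [cite: Nesterenko2003, (4.50); shape only] -/
theorem htermSW_clear {H Sh lev : ℕ} (hH : 1 ≤ H) (hlev : lev < Sh) (i : ℕ × (Fin S.n → ℤ)) {Bv : Fin S.n → ℕ}
    {w : Fin S.n → ℤ} (hw : ∀ j, |(w ᵥ* F.U) j| ≤ (Bv j : ℤ)) (s₁ : ℤ) (τ : Tau S.n) {M₀' : ℤ}
    (hM : (2 : ℝ) ^ ((Sh - (lev + 1)) * τ.1) * ((Nat.lcmUpto H : ℝ) ^ τ.1 *
      (Real.exp (H / Real.exp 1) * (Real.exp 1 * (1 + |((2 ^ (Sh - (lev + 1)) * s₁ : ℤ) : ℝ)| / H)) ^ i.1)) ≤ M₀')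
    {Xb : ℤ} (hX : ∀ k, |S.𝔛 w k| ≤ Xb) :
    (∃ z : ℤ, (((Nat.lcmUpto H) ^ τ.1 * (S.b S.j₀).natAbs ^ (∑ k, τ.2 k) * F.Dh Bv s₁ : ℕ) : ℚ) *
        S.htermSW (S.Rl H Sh lev) s₁ τ i w = z) ∧
    |(S.htermSW (S.Rl H Sh lev) s₁ τ i w : ℝ)| ≤
      (2 : ℝ) ^ τ.1 * M₀' * (Xb : ℝ) ^ (∑ k, τ.2 k) * (F.Dh Bv s₁ : ℝ) := by
  obtain ⟨z₀, hz₀, hz₀le⟩ := S.exists_int_lcm_pow_mul_hasse_Rl hH Sh (lev + 1) i τ.1 s₁ hM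
  obtain ⟨z₂, hz₂, hz₂le⟩ := F.exists_int_Dh_mul_prod_floor hw s₁
  set z₁ : ℤ := ∏ k, S.𝔛 w k ^ τ.2 k with hz₁
  have hz₁le : |z₁| ≤ Xb ^ (∑ k, τ.2 k) := by
    rw [hz₁, Finset.abs_prod, ← Finset.prod_pow_eq_pow_sum]
    refine Finset.prod_le_prod (fun k _ => abs_nonneg _) fun k _ => ?_
    rw [abs_pow]; exact pow_le_pow_left₀ (abs_nonneg _) (hX k) _
  have hhalf := S.hasse_Rl_half (H := H) hlev i τ.1 s₁
  have hγ := S.natAbs_pow_mul_prod_zγ_pow w τ.2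
  have hν : 1 ≤ Nat.lcmUpto H := Nat.lcmUpto_pos H
  have hb1 : 1 ≤ (S.b S.j₀).natAbs := Int.natAbs_pos.mpr S.bj₀_ne
  have hDh1 : 1 ≤ F.Dh Bv s₁ := F.one_le_Dh Bv s₁
  constructor
  · refine ⟨2 ^ τ.1 * z₀ * ((S.b S.j₀).sign ^ (∑ k, τ.2 k) * z₁) * z₂, ?_⟩
    unfold htermSW
    rw [hhalf]
    push_cast
    have e2 := hγ
    push_cast at e2 hz₀ hz₂
    calc ((Nat.lcmUpto H : ℚ)) ^ τ.1 * (((S.b S.j₀).natAbs : ℕ) : ℚ) ^ (∑ k, τ.2 k) * (F.Dh Bv s₁ : ℚ) *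
          (((2 : ℚ) ^ τ.1 * (hasseDeriv τ.1 (S.Rl H Sh (lev + 1) i)).eval (s₁ : ℚ) * (∏ k, S.zγ w k ^ τ.2 k)) *
            ∏ j, S.α j ^ (w j * s₁ / 2))
        = (2 : ℚ) ^ τ.1 * (((Nat.lcmUpto H : ℚ)) ^ τ.1 * (hasseDeriv τ.1 (S.Rl H Sh (lev + 1) i)).eval (s₁ : ℚ)) *
          ((((S.b S.j₀).natAbs : ℕ) : ℚ) ^ (∑ k, τ.2 k) * (∏ k, S.zγ w k ^ τ.2 k)) *
          ((F.Dh Bv s₁ : ℚ) * ∏ j, S.α j ^ (w j * s₁ / 2)) := by ring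
      _ = (2 : ℚ) ^ τ.1 * (z₀ : ℚ) * (((S.b S.j₀).sign : ℚ) ^ (∑ k, τ.2 k) * (z₁ : ℚ)) * (z₂ : ℚ) := by
          rw [hz₀, e2, hz₂, hz₁]; push_cast; ring
  · -- the size
    have hν0 : (0 : ℝ) < (Nat.lcmUpto H : ℝ) ^ τ.1 := by positivity
    have hb0 : (0 : ℝ) < (((S.b S.j₀).natAbs : ℕ) : ℝ) ^ (∑ k, τ.2 k) := by
      have : (0 : ℝ) < (((S.b S.j₀).natAbs : ℕ) : ℝ) := by exact_mod_cast hb1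
      positivity
    have hDh0 : (0 : ℝ) < (F.Dh Bv s₁ : ℝ) := by exact_mod_cast hDh1
    have hA : |((((hasseDeriv τ.1 (S.Rl H Sh lev i)).eval ((s₁ : ℚ) / 2) : ℚ)) : ℝ)| ≤ (2 : ℝ) ^ τ.1 * M₀' := by
      rw [hhalf]
      have h1 : |(((hasseDeriv τ.1 (S.Rl H Sh (lev + 1) i)).eval (s₁ : ℚ) : ℚ) : ℝ)| ≤ M₀' := by
        have hq : ((hasseDeriv τ.1 (S.Rl H Sh (lev + 1) i)).eval (s₁ : ℚ) : ℚ) = (z₀ : ℚ) / ((Nat.lcmUpto H) ^ τ.1 : ℕ) := by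
          rw [eq_div_iff (by exact_mod_cast (pow_pos hν τ.1).ne'), mul_comm]; exact hz₀
        rw [hq]; push_cast
        rw [abs_div, abs_of_pos hν0, div_le_iff₀ hν0]
        have h0 : (0 : ℝ) ≤ M₀' := by exact_mod_cast (abs_nonneg _).trans hz₀le
        calc |(z₀ : ℝ)| ≤ M₀' := by exact_mod_cast hz₀le
          _ = M₀' * 1 := (mul_one _).symm
          _ ≤ M₀' * (Nat.lcmUpto H : ℝ) ^ τ.1 := mul_le_mul_of_nonneg_left (one_le_pow₀ (by exact_mod_cast hν)) h0
      push_cast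
      rw [abs_mul, abs_pow, abs_two]
      exact mul_le_mul_of_nonneg_left h1 (by positivity)
    have hB : |((∏ k, S.zγ w k ^ τ.2 k : ℚ) : ℝ)| ≤ (Xb : ℝ) ^ (∑ k, τ.2 k) := by
      have hq : (∏ k, S.zγ w k ^ τ.2 k : ℚ) = ((S.b S.j₀).sign : ℚ) ^ (∑ k, τ.2 k) * (z₁ : ℚ) / (((S.b S.j₀).natAbs ^ (∑ k, τ.2 k) : ℕ) : ℚ) := by
        rw [eq_div_iff (by exact_mod_cast (pow_pos hb1 _).ne'), mul_comm]; exact hγ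
      rw [hq]; push_cast
      rw [abs_div, abs_mul]
      have hs1 : |(((S.b S.j₀).sign : ℤ) : ℝ) ^ (∑ k, τ.2 k)| = 1 := by
        rw [abs_pow]
        have : |(((S.b S.j₀).sign : ℤ) : ℝ)| = 1 := by
          rcases lt_or_gt_of_ne S.bj₀_ne with h | h
          · rw [Int.sign_eq_neg_one_of_neg h]; norm_num
          · rw [Int.sign_eq_one_of_pos h]; norm_num
        rw [this, one_pow]
      rw [hs1, one_mul, abs_of_pos hb0, div_le_iff₀ hb0]
      have hX0 : (0 : ℝ) ≤ (Xb : ℝ) ^ (∑ k, τ.2 k) := by exact_mod_cast (abs_nonneg _).trans hz₁le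
      calc |(z₁ : ℝ)| ≤ (Xb : ℝ) ^ (∑ k, τ.2 k) := by exact_mod_cast hz₁le
        _ = (Xb : ℝ) ^ (∑ k, τ.2 k) * 1 := (mul_one _).symm
        _ ≤ (Xb : ℝ) ^ (∑ k, τ.2 k) * (((S.b S.j₀).natAbs : ℕ) : ℝ) ^ (∑ k, τ.2 k) :=
            mul_le_mul_of_nonneg_left (one_le_pow₀ (by exact_mod_cast hb1)) hX0
    -- the floor monomial: `|g| ≤ Dh` from `Dh·g = z₂`, `|z₂| ≤ Dh²`
    have hC : |((∏ j, S.α j ^ (w j * s₁ / 2) : ℚ) : ℝ)| ≤ (F.Dh Bv s₁ : ℝ) := by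
      have hq : (∏ j, S.α j ^ (w j * s₁ / 2) : ℚ) = (z₂ : ℚ) / ((F.Dh Bv s₁ : ℕ) : ℚ) := by
        rw [eq_div_iff (by exact_mod_cast (show F.Dh Bv s₁ ≠ 0 by omega)), mul_comm]; exact hz₂
      rw [hq]; push_cast
      rw [abs_div, Nat.abs_cast, div_le_iff₀ hDh0]
      have h := (Int.cast_le (R := ℝ)).mpr hz₂le
      push_cast at h
      rw [← pow_two]
      exact h
    have hB' : |∏ k, ((S.zγ w k : ℚ) : ℝ) ^ τ.2 k| ≤ (Xb : ℝ) ^ (∑ k, τ.2 k) := by push_cast at hB; exact hB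
    have hC' : |∏ j, ((S.α j : ℚ) : ℝ) ^ (w j * s₁ / 2)| ≤ (F.Dh Bv s₁ : ℝ) := by push_cast at hC; exact hC
    unfold htermSW
    push_cast
    rw [abs_mul, abs_mul]
    have h2 : (0 : ℝ) ≤ (2 : ℝ) ^ τ.1 * M₀' := le_trans (abs_nonneg _) hA
    calc |((((hasseDeriv τ.1 (S.Rl H Sh lev i)).eval ((s₁ : ℚ) / 2) : ℚ)) : ℝ)| * |∏ k, ((S.zγ w k : ℚ) : ℝ) ^ τ.2 k| *
          |∏ j, ((S.α j : ℚ) : ℝ) ^ (w j * s₁ / 2)|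
        ≤ ((2 : ℝ) ^ τ.1 * M₀') * (Xb : ℝ) ^ (∑ k, τ.2 k) * (F.Dh Bv s₁ : ℝ) := by
          refine mul_le_mul (mul_le_mul hA hB' (abs_nonneg _) h2) hC' (abs_nonneg _) ?_
          exact mul_nonneg h2 ((abs_nonneg _).trans hB')
      _ = (2 : ℝ) ^ τ.1 * M₀' * (Xb : ℝ) ^ (∑ k, τ.2 k) * (F.Dh Bv s₁ : ℝ) := by ring

/-! ### The closed forms and the half-step package from one inequality -/

/-- The clearing denominator of the signed half-point class-sum terms: `ν(H)^{t₀} · |b̃_{k₀}|^{|t|} · Dh(Bv, s₁)`. [folklore] -/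
def DCsat (Bv : Fin S.n → ℕ) (H : ℕ) (s₁ : ℤ) (τ : Tau S.n) : ℕ :=
  (Nat.lcmUpto H) ^ τ.1 * (S.b S.j₀).natAbs ^ (∑ k, τ.2 k) * F.Dh Bv s₁

/-- The size of the signed half-point class-sum terms: `2^{t₀} · M0C(lev+1) · XbC(Lc)^{|t|} · Dh(Bv, s₁)`. [folklore] -/
def MhCsat (Lc Bv : Fin S.n → ℕ) (L₀ H Sh lev : ℕ) (s₁ : ℤ) (τ : Tau S.n) : ℝ :=
  (2 : ℝ) ^ τ.1 * (M0C L₀ H Sh (lev + 1) s₁ τ.1 : ℝ) * (S.XbC Lc : ℝ) ^ (∑ k, τ.2 k) * (F.Dh Bv s₁ : ℝ)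

/-- `1 ≤ DCsat`. [folklore] -/
theorem one_le_DCsat (Bv : Fin S.n → ℕ) (H : ℕ) (s₁ : ℤ) (τ : Tau S.n) : 1 ≤ S.DCsat F Bv H s₁ τ := by
  unfold DCsat
  exact one_le_mul (one_le_mul (Nat.one_le_pow _ _ (Nat.lcmUpto_pos H)) (Nat.one_le_pow _ _ (Int.natAbs_pos.mpr S.bj₀_ne)))
    (F.one_le_Dh Bv s₁)

/-- `0 ≤ MhCsat`. [folklore] -/
theorem MhCsat_nonneg (Lc Bv : Fin S.n → ℕ) (L₀ H Sh lev : ℕ) (s₁ : ℤ) (τ : Tau S.n) : 0 ≤ S.MhCsat F Lc Bv L₀ H Sh lev s₁ τ := by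
  unfold MhCsat
  have hM := M0C_nonneg' L₀ H Sh (lev + 1) s₁ τ.1
  have hX := XbC_nonneg' S Lc
  positivity

/-- **`HalfStepHypSatU` from one inequality** (`DCsat`, `MhCsat`). [cite: Nesterenko2003, §4.3; shape only] -/
theorem halfStepHypSatU_of_ineqSharp {H Sh lev : ℕ} (hH : 1 ≤ H) (hlev : lev < Sh) (L₀ m : ℕ) (𝔏 : Finset (Fin S.n → ℤ))
    (Lc Bv : Fin S.n → ℕ) (P : ℤ) {N N₁ T T' t : ℕ} (ht : 1 ≤ t) (hT : T' + t ≤ T)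
    (hineq : ∀ s₁ : ℤ, Odd s₁ → |s₁| ≤ (2 * N₁ - 1 : ℤ) → ∀ τ : Tau S.n, tauNorm τ + t ≤ T →
      max (BwP (p := p) L₀ m * ‖S.Λ / (S.b S.j₀ : ℚ_[p])‖ * (p : ℝ) ^ ((t - 1) / 2) * (p : ℝ) ^ condExp p (2 * N + 1) t)
        (BwP (p := p) L₀ m / ((p : ℝ) ^ m * Real.sqrt p) ^ ((2 * N + 1) * t)) <
      (S.DCsat F Bv H s₁ τ : ℝ) / (4 * (S.DCsat F Bv H s₁ τ : ℝ) ^ 2 *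
        (1 + ((S.unk L₀ 𝔏).card : ℝ) * P * S.MhCsat F Lc Bv L₀ H Sh lev s₁ τ) * CW77.heightProd S.α ^ 3) ^ (2 ^ (S.n + 1))) :
    S.HalfStepHypSatU F (S.Rl H Sh lev) (S.Rl H Sh (lev + 1)) (S.unk L₀ 𝔏) Lc Bv P m N N₁ T T' := by
  refine ⟨t, BwP (p := p) L₀ m, fun t₀ => (2 : ℚ) ^ t₀, fun s₁ τ => S.DCsat F Bv H s₁ τ, fun s₁ τ => S.MhCsat F Lc Bv L₀ H Sh lev s₁ τ,
    ht, hT, BwP_nonneg L₀ m, S.hBw_closedP L₀ hH Sh lev m 𝔏, fun t₀ => pow_ne_zero _ two_ne_zero, ?_,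
    fun s₁ τ => S.one_le_DCsat F Bv H s₁ τ, fun s₁ τ => S.MhCsat_nonneg F Lc Bv L₀ H Sh lev s₁ τ, ?_, ?_, hineq⟩
  · intro i _ t₀ s₁
    exact S.hasse_Rl_half (H := H) hlev i t₀ s₁
  · intro s₁ τ i hi w hwc hwv
    have hi1 : i.1 ≤ L₀ := by
      unfold unk at hi; have := (mem_product.mp hi).1; rw [mem_range] at this; omega
    have hM := S.M0C_spec (p := p) hH L₀ Sh (lev + 1) i hi1 s₁ τ.1
    exact (S.htermSW_clear F hH hlev i hwv s₁ τ hM (S.hXb_closed Lc w hwc)).1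
  · intro s₁ τ i hi w hwc hwv
    have hi1 : i.1 ≤ L₀ := by
      unfold unk at hi; have := (mem_product.mp hi).1; rw [mem_range] at this; omega
    have hM := S.M0C_spec (p := p) hH L₀ Sh (lev + 1) i hi1 s₁ τ.1
    have h := (S.htermSW_clear F hH hlev i hwv s₁ τ hM (S.hXb_closed Lc w hwc)).2
    unfold MhCsat
    exact h

end G3Setup

end Summit.ABC.StewartYu

end
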